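import Mathlib
import HarnessLib
import Literature.Computability.AlgebraicComplexity.PatternExpressions
import Literature.Combinatorics.SimpleGraph.TreeDecomposition
import Summits.ValiantsHypothesis.ValiantsHypothesis.Theorems.MonotoneRestorationOrbitRestorationQPHomSpan

/-!
# The polylog-degree floor of K1 `NarrowExpansionVP` in SPAN currency

Route MonotoneRestoration, crux `OrbitRestorationQP` (stmt-18293).  K1 (`NarrowExpansionVP`, the single
remaining binder of the counting-width split, `orbitRestorationQP_of_narrowExpansionVP`) asks that every
matrix-symmetric `VP` family lie, level by level, in the `ℂ`-span of the homomorphism polynomials of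
bipartite patterns of treewidth `≤ (log₂ n + c)^c`.  By the spanning theorem
`HomSpan.mem_span_homPoly_of_matrixSymmetric` every matrix-symmetric polynomial of degree `d` lies in the
span of `hom_{F,n}` over patterns with `≤ d` vertices a side, whose treewidth is `≤ 2d - 1`
(`treewidth_le_card_sub_one`).  Hence:

* `mem_narrowSpan_of_degree_le` — a matrix-symmetric polynomial of degree `≤ d` lies in the span of the
  homomorphism polynomials of patterns of treewidth `≤ 2d`;
* `narrowExpansion_of_polylogDegree` — **the floor of K1**: every matrix-symmetric family of degree
  `≤ (log₂ n + c)^c` satisfies K1's conclusion (span of patterns of treewidth `≤ (log₂ n + c')^{c'}`),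
  with NO `VP` hypothesis.  So K1's content is exactly the treewidth bound for families of
  super-polylogarithmic degree (compare `perPoly_not_mem_narrowSpan`: the permanent, degree `n`, is not
  narrowly expandable).

Helper file (`--supports stmt-ValiantsHypothesis-16191`, whose `stub_orbitRestoration` is this crux by
name); def-free. [cite: DwivediPagoSeppelt2026, §8]
-/

noncomputable section

open MvPolynomial

-- `Summit.ValiantsHypothesis.ValiantsHypothesis.…` is the tree's single-conjunct layout (Sub = Summit).
set_option linter.dupNamespace false

namespace Summit.ValiantsHypothesis.ValiantsHypothesis.Theorems

namespace HomSpan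

open Literature.Computability.AlgebraicComplexity

variable {n : ℕ}

/-- **Matrix-symmetric polynomials of degree `≤ d` lie in the span of the homomorphism polynomials of
patterns of treewidth `≤ 2d`.** [folklore] -/
theorem mem_narrowSpan_of_degree_le (p : MvPolynomial (Fin n × Fin n) ℂ)
    (hp : ∀ σ τ : Equiv.Perm (Fin n), rename (fun ij : Fin n × Fin n => (σ ij.1, τ ij.2)) p = p)
    {d : ℕ} (hd : p.totalDegree ≤ d) :
    p ∈ Submodule.span ℂ
        {q : MvPolynomial (Fin n × Fin n) ℂ | ∃ (a b : ℕ) (E : Multiset (Fin a × Fin b)),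
          Literature.Combinatorics.SimpleGraph.treewidth
              (SimpleGraph.fromRel fun u v : Fin a ⊕ Fin b =>
                ∃ e ∈ E, u = Sum.inl e.1 ∧ v = Sum.inr e.2) ≤ 2 * d ∧
            q = homPoly E n ℂ} := by
  refine Submodule.span_mono (fun q => ?_) (mem_span_homPoly_of_matrixSymmetric p hp)
  rintro ⟨a, b, E, ha, hb, -, rfl⟩
  refine ⟨a, b, E, (Literature.Combinatorics.SimpleGraph.treewidth_le_card_sub_one _).trans ?_, rfl⟩
  simp only [Fintype.card_sum, Fintype.card_fin]
  omega

/-- **The floor of K1 `NarrowExpansionVP` (VP-free).**  Every matrix-symmetric family of total degree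
`≤ (log₂ n + c)^c` lies, level by level, in the `ℂ`-span of the homomorphism polynomials of bipartite
patterns of treewidth `≤ (log₂ n + c')^{c'}` (`c' = c + 2`) — verbatim the conclusion of K1 as it appears in
`orbitRestorationQP_of_narrowExpansionVP`. [folklore] -/
theorem narrowExpansion_of_polylogDegree (f : (n : ℕ) → MvPolynomial (Fin n × Fin n) ℂ)
    (hsymm : ∀ (n : ℕ) (σ τ : Equiv.Perm (Fin n)),
      rename (fun p : Fin n × Fin n => (σ p.1, τ p.2)) (f n) = f n)
    (hdeg : ∃ c : ℕ, ∀ n : ℕ, (f n).totalDegree ≤ (Nat.log 2 n + c) ^ c) :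
    ∃ c : ℕ, ∀ n : ℕ, f n ∈ Submodule.span ℂ
        {p : MvPolynomial (Fin n × Fin n) ℂ | ∃ (a b : ℕ) (E : Multiset (Fin a × Fin b)),
          Literature.Combinatorics.SimpleGraph.treewidth
              (SimpleGraph.fromRel fun u v : Fin a ⊕ Fin b =>
                ∃ e ∈ E, u = Sum.inl e.1 ∧ v = Sum.inr e.2) ≤ (Nat.log 2 n + c) ^ c ∧
            p = homPoly E n ℂ} := by
  obtain ⟨c, hc⟩ := hdeg
  refine ⟨c + 2, fun n => ?_⟩
  refine Submodule.span_mono (fun q => ?_) (mem_narrowSpan_of_degree_le (f n) (hsymm n) (hc n))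
  rintro ⟨a, b, E, htw, rfl⟩
  refine ⟨a, b, E, htw.trans ?_, rfl⟩
  -- `2 (L + c)^c ≤ (L + c + 2)^(c + 2)`
  calc 2 * (Nat.log 2 n + c) ^ c ≤ (Nat.log 2 n + (c + 2)) ^ 2 * (Nat.log 2 n + (c + 2)) ^ c := by
        refine Nat.mul_le_mul ?_ (Nat.pow_le_pow_left (by omega) c)
        nlinarith [Nat.zero_le (Nat.log 2 n + c)]
    _ = (Nat.log 2 n + (c + 2)) ^ (c + 2) := by rw [← pow_add, add_comm 2 c]
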